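/-
Copyright (c) 2026 the pub-hodgecm-mathlib formalisation cell (harness21).  Prover seat hodgecm-mathlib-K2E1-p15 (g3), Track B ∕ K2-LIT, h413 = `stmt-HodgeConjecture-24833`,
R90-TF section S8 «ContSpec-n½», #4′ road, MODEL-FAMILY brick item §3 «OD instantiation» (census `R90/S8/CENSUS-ModelFamily.K2E1-p15-g3.md`, S8-R49 «=»): the OFF-DUAL block `Sc(K′, ω, χ)`
IS right-modelled — its Plancherel isometry onto `L²(ℝ × K_max)` exists at EVERY level datum `(K′, ω)` (★ letter-free D4′ engine), so `hOD` is DISCHARGED for off-dual blocks.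
-/
import Summits.HodgeConjecture.HodgeConjecture.Theorems.R90S8ResHBlockModelFamilyU2              -- ★ p862602 (this seat): `resHAtom_odModelMap_eq_bot`, `hχb_of_isUnitary`, `completeSpace_resHBlock` (+ ★ DEFS p862464)
import Summits.HodgeConjecture.HodgeConjecture.Theorems.K2E1ChiSectionPlancherelGramDischargeCMTwo  -- ★ p860754 (K2E3-p12): `exists_repr_and_linearIsometry_chiSection_offDual_letterFree_cm_two` (the off-dual block isometry, letter-free)
import Summits.HodgeConjecture.HodgeConjecture.Theorems.K2E1ChiPseudoEisensteinFamiliesOrthogonalCMTwo -- ★ p861668 (K2E1-p16) R6 §1: `topologicalClosure_span_continuous_eq_smooth_kType` (continuous-profile and smooth-profile bricks have the same closed span)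
import HarnessLib

/-!
# S8 #4′ road — `R90S8ResHBlockOffDualModelU2`: the off-dual block `Sc(K′, ω, χ)` (`χʷ ≁ χ`) carries a Plancherel isometry `Sc →ₗᵢ L²(ℝ × K_max)` at EVERY level `(K′, ω)` — hence `At = ⊥`,
# `Ln = Sc` and the model letter `hOD` of (O) holds for it (MODEL-FAMILY §3)

Track B ∕ K2-LIT, crux h413 = `stmt-HodgeConjecture-24833`, route of record `HCCMUnconditional`; cell `hodgecm-mathlib`, R90-TF programme, section S8 «ContSpec-n½», socket #4′
`sock_S8_resH_spannedByCharLines` (B ED. 4 :256).  THEOREMS ONLY (no `def`, no `instance`, no `notation`, no named-fact hypothesis, no `sorry`; default heartbeats); lane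
`--supports stmt-HodgeConjecture-24833 --as helper` (count-neutral).  CLOSES NO SOCKET.  It instantiates the ★ LETTER-FREE off-dual D4′ engine at the R1 block of record: for a UNITARY
OFF-DUAL `χ` (`¬ (χ·(χʷ)⁻¹).IsNormTwist`) and ANY level datum `(K′, ω)`, modulo ONLY ★ R6's structural Haar ∕ fundamental-domain data `νG μK νI 𝓕I ν 𝓕` (the same binders (O) ★ p862491
carries), the block `Sc = resHBlock K′ ω χ` is the closed span of an indexed brick family `x` with a linear isometry `U : Sc →ₗᵢ L²(ℝ × K_max, dy ⊗ μ_K)` sending each brick `[θ_{f,φ}]` to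
`√(C∕2π)·(f̃(−½ − iy)·φ(k))` — so the off-dual blocks of the C7 index are RIGHT-MODELLED in the sense of ★ `exists_blockModelFamily`, `resHAtom = ⊥` and `resHLine = resHBlock` for them, and
(O)'s `hOD` needs no letter there.

THE MATHEMATICS ([MoeglinWaldspurger1995, II.1.2–II.1.3, II.2.1, IV.1.10 (off-dual rank-one blocks have no residual part)]; [Folland1999, Prop. 8.17]).  ★ D4′ (`K2E1ChiSectionPlancherelGramDischarge…`)
proves: for unitary off-dual `χ` and ANY family of bricks `(f_i ∈ C²_c((0,∞)), φ_i` a continuous bounded `χ`-section) the classes `[θ_{f_i,φ_i}] ∈ L²(𝔛, μ)` span a closed subspace carrying a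
linear ISOMETRY onto the closed span of the model vectors `u_i(y, k) = f̃_i(−½ − iy)·φ_i(k)` in `L²(ℝ × K_max)` (Mellin–Plancherel + the vanishing of the off-dual cross term).  Here: (§1) the block
`Sc(K′, ω, χ)` — closed span of the CONTINUOUS-profile bricks with `φ ∈ V(χ, K′, ω)` — equals the closed span of the SMOOTH-profile ones (★ R6 §1, its letter `hχb` discharged by unitarity, ★
`hχb_of_isUnitary`); (§2) indexing the smooth bricks by `ι = {(f, φ)}` and choosing the ★ representatives `x_i`, `closure span (range x) = Sc`; (§3) ★ D4′ at this family gives the isometry on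
`closure span (range x)`, transported to `Sc` along the equality (Mathlib `LinearIsometryEquiv.ofEq`); (§4) with ★ `resHAtom_odModelMap_eq_bot`: `At = ⊥` for the model `(0, U ∘ P_{Sc})`.
* §1 `resHBlock_eq_topologicalClosure_span_smooth` (χ unitary).  §2 `range_brickFamily_eq`, `topologicalClosure_span_range_eq_resHBlock`.
* §3 **`exists_offDual_isometry_resHBlock`** — `∃ C > 0, x, u, U` with ★ D4′'s four clauses AND `closure span (range x) = resHBlock K′ ω χ`; **`exists_offDual_isometry_resHBlock'`** — the
  transported `U_od : ↥(resHBlock K′ ω χ) →ₗᵢ[ℂ] L²(ℝ × K_max)` with its value on every smooth brick.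
* §4 **`exists_odModelMap_resHAtom_eq_bot`** — `hOD` DISCHARGED for off-dual blocks: an off-dual model map `U = (0, U_od ∘ P_{Sc})` with `resHAtom U = ⊥` (and `resHLine U = resHBlock`) exists.
HONEST LABEL: HC_CM is proved only modulo the 7 printed citations (2 remaining named inputs: hLiu418 = `stmt-HodgeConjecture-24832`, h413 = `stmt-HodgeConjecture-24833`) until
rung 0 closes; REL ≠ ★ ≠ BUILT; this file asserts no named fact, is conditional on the visible structural data, and closes no socket; count-neutral.

## References
* [MoeglinWaldspurger1995] C. Mœglin, J.-L. Waldspurger, *Spectral Decomposition and Eisenstein Series* (1995), II.1.2–II.1.3, II.2.1, IV.1.10.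
* [Folland1999] G. B. Folland, *Real Analysis*, 2nd ed. (1999), Prop. 8.17.
-/

set_option autoImplicit false
set_option linter.dupNamespace false  -- the mandated namespace `…HodgeConjecture.HodgeConjecture.R90.S8` (LEAD #1 L1) repeats the summit's segment

noncomputable section

open MeasureTheory Measure Set Filter Topology Complex NumberField IsDedekindDomain
open scoped Real NNReal ENNReal InnerProductSpace
open Literature.NumberTheory Literature.NumberTheory.Automorphic Literature.NumberTheory.Automorphic.UnitaryGroup Literature.NumberTheory.GaloisRepresentations AdelicGroupData
open Summit.HodgeConjecture.HodgeConjecture.Cruxes.H413.K2E1BorelEisensteinU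
open Summit.HodgeConjecture.HodgeConjecture.Cruxes.H413.K2E1CharacterEisensteinU2Defs
open Summit.HodgeConjecture.HodgeConjecture.Cruxes.H413.K2E1ChiSectionSpaceU2Defs
open Summit.HodgeConjecture.HodgeConjecture.Cruxes.H413.K2E1ChiSectionPlancherelGramDischargeCMTwo (exists_repr_and_linearIsometry_chiSection_offDual_letterFree_cm_two)
open Summit.HodgeConjecture.HodgeConjecture.Cruxes.H413.K2E1ChiPseudoEisensteinFamiliesOrthogonalCMTwo (topologicalClosure_span_continuous_eq_smooth_kType)
open Summit.HodgeConjecture.HodgeConjecture.Cruxes.H413.K2E1PlancherelIsometryOfForm (mem_topologicalClosure_span)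

namespace Summit.HodgeConjecture.HodgeConjecture.R90.S8

variable (L : Type) [Field L] [NumberField L] [IsCMField L]
  [MeasurableSpace (quasiSplit (↥(maximalRealSubfield L)) L (IsCMField.complexConj L) 2).Adelic] [BorelSpace (quasiSplit (↥(maximalRealSubfield L)) L (IsCMField.complexConj L) 2).Adelic]
  [MeasurableSpace (AdeleRing (𝓞 L) L)ˣ] [BorelSpace (AdeleRing (𝓞 L) L)ˣ]
  (μ : Measure (quasiSplit (↥(maximalRealSubfield L)) L (IsCMField.complexConj L) 2).automorphicQuotient) [(quasiSplit (↥(maximalRealSubfield L)) L (IsCMField.complexConj L) 2).IsAutomorphicMeasure μ]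
  (K' : Subgroup (quasiSplit (↥(maximalRealSubfield L)) L (IsCMField.complexConj L) 2).Adelic) (ω : ↥K' →* ℂ)

/-! ## §1 The block is the closed span of the SMOOTH-profile bricks -/

omit [MeasurableSpace (AdeleRing (𝓞 L) L)ˣ] [BorelSpace (AdeleRing (𝓞 L) L)ˣ] in
/-- **`Sc(K′, ω, χ)` = closure span {smooth-profile bricks}** for `χ` unitary: ★ R6 §1 `topologicalClosure_span_continuous_eq_smooth_kType`, its bounded-section letter discharged by ★ `hχb_of_isUnitary`.
[cite: MoeglinWaldspurger1995, II.1.2–II.1.3] [cite: Folland1999, Prop. 8.17] -/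
theorem resHBlock_eq_topologicalClosure_span_smooth {χ : HeckeCharacter L} (hχu : χ.IsUnitary) :
    resHBlock L μ K' ω χ =
      (Submodule.span ℂ {v : (quasiSplit (↥(maximalRealSubfield L)) L (IsCMField.complexConj L) 2).L2 μ |
        ∃ (f : ℝ → ℂ) (_ : ContDiff ℝ (⊤ : ℕ∞) f) (_ : Continuous f) (_ : HasCompactSupport f) (_ : tsupport f ⊆ Ioi 0)
          (φ : (quasiSplit (↥(maximalRealSubfield L)) L (IsCMField.complexConj L) 2).Adelic → ℂ) (_ : φ ∈ chiSectionSpace χ K' (ω : ↥K' → ℂ)) (_ : Continuous φ)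
          (hv : MemLp ((quasiSplit (↥(maximalRealSubfield L)) L (IsCMField.complexConj L) 2).quotFun (eisensteinSeriesU (fun g => f (borelHeight g) * φ g))) 2 μ), v = hv.toLp _}).topologicalClosure := by
  rw [resHBlock_def]
  exact topologicalClosure_span_continuous_eq_smooth_kType L μ χ K' (ω : ↥K' → ℂ) (hχb_of_isUnitary L K' ω hχu)

/-! ## §2 The smooth bricks as an indexed family of `L²` classes -/

omit [MeasurableSpace (quasiSplit (↥(maximalRealSubfield L)) L (IsCMField.complexConj L) 2).Adelic] [BorelSpace (quasiSplit (↥(maximalRealSubfield L)) L (IsCMField.complexConj L) 2).Adelic]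
  [MeasurableSpace (AdeleRing (𝓞 L) L)ˣ] [BorelSpace (AdeleRing (𝓞 L) L)ˣ] [(quasiSplit (↥(maximalRealSubfield L)) L (IsCMField.complexConj L) 2).IsAutomorphicMeasure μ] in
/-- **The range of a brick family IS the set of smooth bricks**: if `x` indexes, over the smooth brick data `ι = {(f, φ)}`, `L²` classes a.e. equal to the bricks, then `range x` is exactly ★ R6 §1's
smooth brick set (`Lp` extensionality). [cite: MoeglinWaldspurger1995, II.1.2] -/
theorem range_brickFamily_eq (χ : HeckeCharacter L)
    (x : ↥{p : (ℝ → ℂ) × ((quasiSplit (↥(maximalRealSubfield L)) L (IsCMField.complexConj L) 2).Adelic → ℂ) |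
        ContDiff ℝ (⊤ : ℕ∞) p.1 ∧ HasCompactSupport p.1 ∧ tsupport p.1 ⊆ Ioi 0 ∧ p.2 ∈ chiSectionSpace χ K' (ω : ↥K' → ℂ) ∧ Continuous p.2} →
      (quasiSplit (↥(maximalRealSubfield L)) L (IsCMField.complexConj L) 2).L2 μ)
    (hx : ∀ i, (x i : (quasiSplit (↥(maximalRealSubfield L)) L (IsCMField.complexConj L) 2).automorphicQuotient → ℂ) =ᵐ[μ]
      (quasiSplit (↥(maximalRealSubfield L)) L (IsCMField.complexConj L) 2).quotFun (eisensteinSeriesU (fun g : (quasiSplit (↥(maximalRealSubfield L)) L (IsCMField.complexConj L) 2).Adelic =>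
        (i : (ℝ → ℂ) × ((quasiSplit (↥(maximalRealSubfield L)) L (IsCMField.complexConj L) 2).Adelic → ℂ)).1 (borelHeight g : ℝ) * (i : (ℝ → ℂ) × ((quasiSplit (↥(maximalRealSubfield L)) L (IsCMField.complexConj L) 2).Adelic → ℂ)).2 g))) :
    Set.range x = {v : (quasiSplit (↥(maximalRealSubfield L)) L (IsCMField.complexConj L) 2).L2 μ |
        ∃ (f : ℝ → ℂ) (_ : ContDiff ℝ (⊤ : ℕ∞) f) (_ : Continuous f) (_ : HasCompactSupport f) (_ : tsupport f ⊆ Ioi 0)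
          (φ : (quasiSplit (↥(maximalRealSubfield L)) L (IsCMField.complexConj L) 2).Adelic → ℂ) (_ : φ ∈ chiSectionSpace χ K' (ω : ↥K' → ℂ)) (_ : Continuous φ)
          (hv : MemLp ((quasiSplit (↥(maximalRealSubfield L)) L (IsCMField.complexConj L) 2).quotFun (eisensteinSeriesU (fun g => f (borelHeight g) * φ g))) 2 μ), v = hv.toLp _} := by
  ext v
  constructor
  · rintro ⟨i, rfl⟩
    obtain ⟨⟨f, φ⟩, hf, hfs, hf0, hφ, hφc⟩ := i
    have hv : MemLp ((quasiSplit (↥(maximalRealSubfield L)) L (IsCMField.complexConj L) 2).quotFun (eisensteinSeriesU (fun g => f (borelHeight g) * φ g))) 2 μ :=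
      (Lp.memLp (x ⟨(f, φ), hf, hfs, hf0, hφ, hφc⟩)).ae_eq (hx ⟨(f, φ), hf, hfs, hf0, hφ, hφc⟩)
    refine ⟨f, hf, hf.continuous, hfs, hf0, φ, hφ, hφc, hv, ?_⟩
    exact Lp.ext ((hx ⟨(f, φ), hf, hfs, hf0, hφ, hφc⟩).trans hv.coeFn_toLp.symm)
  · rintro ⟨f, hf, -, hfs, hf0, φ, hφ, hφc, hv, rfl⟩
    refine ⟨⟨(f, φ), hf, hfs, hf0, hφ, hφc⟩, ?_⟩
    exact Lp.ext ((hx ⟨(f, φ), hf, hfs, hf0, hφ, hφc⟩).trans hv.coeFn_toLp.symm)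

omit [MeasurableSpace (AdeleRing (𝓞 L) L)ˣ] [BorelSpace (AdeleRing (𝓞 L) L)ˣ] in
/-- **`closure span (range x) = Sc(K′, ω, χ)`** for every brick family `x` over the smooth brick data (χ unitary): §2 + §1. [cite: MoeglinWaldspurger1995, II.1.2–II.1.3] -/
theorem topologicalClosure_span_range_eq_resHBlock {χ : HeckeCharacter L} (hχu : χ.IsUnitary)
    (x : ↥{p : (ℝ → ℂ) × ((quasiSplit (↥(maximalRealSubfield L)) L (IsCMField.complexConj L) 2).Adelic → ℂ) |
        ContDiff ℝ (⊤ : ℕ∞) p.1 ∧ HasCompactSupport p.1 ∧ tsupport p.1 ⊆ Ioi 0 ∧ p.2 ∈ chiSectionSpace χ K' (ω : ↥K' → ℂ) ∧ Continuous p.2} →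
      (quasiSplit (↥(maximalRealSubfield L)) L (IsCMField.complexConj L) 2).L2 μ)
    (hx : ∀ i, (x i : (quasiSplit (↥(maximalRealSubfield L)) L (IsCMField.complexConj L) 2).automorphicQuotient → ℂ) =ᵐ[μ]
      (quasiSplit (↥(maximalRealSubfield L)) L (IsCMField.complexConj L) 2).quotFun (eisensteinSeriesU (fun g : (quasiSplit (↥(maximalRealSubfield L)) L (IsCMField.complexConj L) 2).Adelic =>
        (i : (ℝ → ℂ) × ((quasiSplit (↥(maximalRealSubfield L)) L (IsCMField.complexConj L) 2).Adelic → ℂ)).1 (borelHeight g : ℝ) * (i : (ℝ → ℂ) × ((quasiSplit (↥(maximalRealSubfield L)) L (IsCMField.complexConj L) 2).Adelic → ℂ)).2 g))) :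
    (Submodule.span ℂ (Set.range x)).topologicalClosure = resHBlock L μ K' ω χ := by
  rw [range_brickFamily_eq L μ K' ω χ x hx, resHBlock_eq_topologicalClosure_span_smooth L μ K' ω hχu]

/-! ## §3 The off-dual block isometry at `(K′, ω)` -/

/-- **THE OFF-DUAL BLOCK `Sc(K′, ω, χ)` IS RIGHT-MODELLED (★ D4′, letter-free)**: for `χ` unitary and off-dual and ANY level datum `(K′, ω)`, there are a constant `C > 0`, a brick family `x` over the
smooth brick data with `closure span (range x) = Sc`, model vectors `u_i(y,k) = f̃_i(−½ − iy)·φ_i(k)` in `L²(ℝ × K_max)`, and a linear ISOMETRY `U : closure span (range x) →ₗᵢ L²(ℝ × K_max)` with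
`U [θ_{f_i,φ_i}] = √(C∕2π)·u_i` and `range U = closure span {√(C∕2π)·u_i}` — ★ `exists_repr_and_linearIsometry_chiSection_offDual_letterFree_cm_two` at this family (sections bounded by unitarity).
Visible: ★ R6's structural Haar ∕ fundamental-domain data only. [cite: MoeglinWaldspurger1995, II.2.1, IV.1.10] -/
theorem exists_offDual_isometry_resHBlock
    (νG : Measure (quasiSplit (↥(maximalRealSubfield L)) L (IsCMField.complexConj L) 2).Adelic) [νG.IsHaarMeasure] [νG.IsInvInvariant]
    (μK : Measure ((standardMaximalCompactGL 2 L).comap (adelicVal (↥(maximalRealSubfield L)) L (IsCMField.complexConj L) 2 ((StdForm.antidiagonal 2).over L)) : Subgroup (quasiSplit (↥(maximalRealSubfield L)) L (IsCMField.complexConj L) 2).Adelic)) [μK.IsHaarMeasure]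
    (νI : Measure (AdeleRing (𝓞 L) L)ˣ) [νI.IsHaarMeasure]
    {𝓕I : Set (AdeleRing (𝓞 L) L)ˣ} (h𝓕I : IsIdeleClassDomain L 𝓕I)
    (ν : Measure ↥(adelicUnipotent (↥(maximalRealSubfield L)) L (IsCMField.complexConj L) 2)) [ν.IsHaarMeasure] {𝓕 : Set ↥(adelicUnipotent (↥(maximalRealSubfield L)) L (IsCMField.complexConj L) 2)}
    (h𝓕N : IsFundamentalDomain ↥(rationalUnipotent (↥(maximalRealSubfield L)) L (IsCMField.complexConj L) 2) 𝓕 ν) (h𝓕c : IsCompact (closure 𝓕)) (h𝓕₀ : ν 𝓕 ≠ 0)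
    {χ : HeckeCharacter L} (hχu : χ.IsUnitary) (hoff : ¬ (χ * (reflectChar (IsCMField.complexConj L) χ)⁻¹).IsNormTwist) :
    ∃ (C : ℝ) (_ : 0 < C)
      (x : ↥{p : (ℝ → ℂ) × ((quasiSplit (↥(maximalRealSubfield L)) L (IsCMField.complexConj L) 2).Adelic → ℂ) |
          ContDiff ℝ (⊤ : ℕ∞) p.1 ∧ HasCompactSupport p.1 ∧ tsupport p.1 ⊆ Ioi 0 ∧ p.2 ∈ chiSectionSpace χ K' (ω : ↥K' → ℂ) ∧ Continuous p.2} →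
        (quasiSplit (↥(maximalRealSubfield L)) L (IsCMField.complexConj L) 2).L2 μ)
      (u : ↥{p : (ℝ → ℂ) × ((quasiSplit (↥(maximalRealSubfield L)) L (IsCMField.complexConj L) 2).Adelic → ℂ) |
          ContDiff ℝ (⊤ : ℕ∞) p.1 ∧ HasCompactSupport p.1 ∧ tsupport p.1 ⊆ Ioi 0 ∧ p.2 ∈ chiSectionSpace χ K' (ω : ↥K' → ℂ) ∧ Continuous p.2} →
        Lp ℂ 2 ((volume : Measure ℝ).prod μK))
      (U : ↥(Submodule.span ℂ (Set.range x)).topologicalClosure →ₗᵢ[ℂ] Lp ℂ 2 ((volume : Measure ℝ).prod μK)),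
      (∀ i, (x i : (quasiSplit (↥(maximalRealSubfield L)) L (IsCMField.complexConj L) 2).automorphicQuotient → ℂ) =ᵐ[μ]
        (quasiSplit (↥(maximalRealSubfield L)) L (IsCMField.complexConj L) 2).quotFun (eisensteinSeriesU (fun g : (quasiSplit (↥(maximalRealSubfield L)) L (IsCMField.complexConj L) 2).Adelic =>
          (i : (ℝ → ℂ) × ((quasiSplit (↥(maximalRealSubfield L)) L (IsCMField.complexConj L) 2).Adelic → ℂ)).1 (borelHeight g : ℝ) * (i : (ℝ → ℂ) × ((quasiSplit (↥(maximalRealSubfield L)) L (IsCMField.complexConj L) 2).Adelic → ℂ)).2 g))) ∧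
      (∀ i, (u i : ℝ × ((standardMaximalCompactGL 2 L).comap (adelicVal (↥(maximalRealSubfield L)) L (IsCMField.complexConj L) 2 ((StdForm.antidiagonal 2).over L)) : Subgroup (quasiSplit (↥(maximalRealSubfield L)) L (IsCMField.complexConj L) 2).Adelic) → ℂ) =ᵐ[(volume : Measure ℝ).prod μK]
        fun p => mellin (i : (ℝ → ℂ) × ((quasiSplit (↥(maximalRealSubfield L)) L (IsCMField.complexConj L) 2).Adelic → ℂ)).1 (-((((1 / 2 : ℝ)) : ℂ) + p.1 * I)) *
          (i : (ℝ → ℂ) × ((quasiSplit (↥(maximalRealSubfield L)) L (IsCMField.complexConj L) 2).Adelic → ℂ)).2 (p.2 : (quasiSplit (↥(maximalRealSubfield L)) L (IsCMField.complexConj L) 2).Adelic)) ∧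
      (∀ i, U ⟨x i, mem_topologicalClosure_span x i⟩ = ((Real.sqrt (C * (2 * π)⁻¹) : ℝ) : ℂ) • u i) ∧
      Set.range U = ((Submodule.span ℂ (Set.range fun i => ((Real.sqrt (C * (2 * π)⁻¹) : ℝ) : ℂ) • u i)).topologicalClosure : Set (Lp ℂ 2 ((volume : Measure ℝ).prod μK))) ∧
      (Submodule.span ℂ (Set.range x)).topologicalClosure = resHBlock L μ K' ω χ := by
  obtain ⟨C, hC, hfam⟩ := exists_repr_and_linearIsometry_chiSection_offDual_letterFree_cm_two L μ νG μK νI h𝓕I ν h𝓕N h𝓕c h𝓕₀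
  -- ★ D4′ at the smooth-brick family of the block (profiles `C^∞ ⊆ C²`; sections bounded by unitarity)
  have H := @hfam
    ↥{p : (ℝ → ℂ) × ((quasiSplit (↥(maximalRealSubfield L)) L (IsCMField.complexConj L) 2).Adelic → ℂ) |
        ContDiff ℝ (⊤ : ℕ∞) p.1 ∧ HasCompactSupport p.1 ∧ tsupport p.1 ⊆ Ioi 0 ∧ p.2 ∈ chiSectionSpace χ K' (ω : ↥K' → ℂ) ∧ Continuous p.2}
    χ (fun i => (i : (ℝ → ℂ) × ((quasiSplit (↥(maximalRealSubfield L)) L (IsCMField.complexConj L) 2).Adelic → ℂ)).1)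
    (fun i => (i : (ℝ → ℂ) × ((quasiSplit (↥(maximalRealSubfield L)) L (IsCMField.complexConj L) 2).Adelic → ℂ)).2) hχu hoff
    (fun i => by obtain ⟨hf, -, -, -, -⟩ := i.2; exact hf.of_le (WithTop.coe_le_coe.2 le_top))
    (fun i => i.2.2.1) (fun i => i.2.2.2.1)
    (fun i => by obtain ⟨-, -, -, hφ, -⟩ := i.2; exact hφ.1)
    (fun i => i.2.2.2.2.2)
    (fun i => by obtain ⟨-, -, -, hφ, hφc⟩ := i.2; exact hχb_of_isUnitary L K' ω hχu _ hφ hφc)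
  obtain ⟨x, u, hx, hu, U, hU, hrange⟩ := H
  refine ⟨C, hC, x, u, U, hx, hu, hU, hrange, ?_⟩
  exact topologicalClosure_span_range_eq_resHBlock L μ K' ω hχu x hx

/-- **THE OFF-DUAL ISOMETRY ON `Sc(K′, ω, χ)` ITSELF** (§3 transported along `closure span (range x) = Sc`, Mathlib `LinearIsometryEquiv.ofEq`): `∃ U_od : Sc →ₗᵢ L²(ℝ × K_max)` taking each smooth
brick `[θ_{f,φ}]` to `√(C∕2π)·(f̃(−½ − iy)·φ(k))`. [cite: MoeglinWaldspurger1995, II.2.1, IV.1.10] -/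
theorem exists_offDual_isometry_resHBlock'
    (νG : Measure (quasiSplit (↥(maximalRealSubfield L)) L (IsCMField.complexConj L) 2).Adelic) [νG.IsHaarMeasure] [νG.IsInvInvariant]
    (μK : Measure ((standardMaximalCompactGL 2 L).comap (adelicVal (↥(maximalRealSubfield L)) L (IsCMField.complexConj L) 2 ((StdForm.antidiagonal 2).over L)) : Subgroup (quasiSplit (↥(maximalRealSubfield L)) L (IsCMField.complexConj L) 2).Adelic)) [μK.IsHaarMeasure]
    (νI : Measure (AdeleRing (𝓞 L) L)ˣ) [νI.IsHaarMeasure]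
    {𝓕I : Set (AdeleRing (𝓞 L) L)ˣ} (h𝓕I : IsIdeleClassDomain L 𝓕I)
    (ν : Measure ↥(adelicUnipotent (↥(maximalRealSubfield L)) L (IsCMField.complexConj L) 2)) [ν.IsHaarMeasure] {𝓕 : Set ↥(adelicUnipotent (↥(maximalRealSubfield L)) L (IsCMField.complexConj L) 2)}
    (h𝓕N : IsFundamentalDomain ↥(rationalUnipotent (↥(maximalRealSubfield L)) L (IsCMField.complexConj L) 2) 𝓕 ν) (h𝓕c : IsCompact (closure 𝓕)) (h𝓕₀ : ν 𝓕 ≠ 0)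
    {χ : HeckeCharacter L} (hχu : χ.IsUnitary) (hoff : ¬ (χ * (reflectChar (IsCMField.complexConj L) χ)⁻¹).IsNormTwist) :
    ∃ (C : ℝ) (_ : 0 < C) (Uod : ↥(resHBlock L μ K' ω χ) →ₗᵢ[ℂ] Lp ℂ 2 ((volume : Measure ℝ).prod μK)),
      ∀ (f : ℝ → ℂ) (hf : ContDiff ℝ (⊤ : ℕ∞) f) (hfs : HasCompactSupport f) (hf0 : tsupport f ⊆ Ioi 0)
        (φ : (quasiSplit (↥(maximalRealSubfield L)) L (IsCMField.complexConj L) 2).Adelic → ℂ) (hφ : φ ∈ chiSectionSpace χ K' (ω : ↥K' → ℂ)) (hφc : Continuous φ)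
        (hv : MemLp ((quasiSplit (↥(maximalRealSubfield L)) L (IsCMField.complexConj L) 2).quotFun (eisensteinSeriesU (fun g => f (borelHeight g) * φ g))) 2 μ)
        (hw : MemLp (fun p : ℝ × ((standardMaximalCompactGL 2 L).comap (adelicVal (↥(maximalRealSubfield L)) L (IsCMField.complexConj L) 2 ((StdForm.antidiagonal 2).over L)) : Subgroup (quasiSplit (↥(maximalRealSubfield L)) L (IsCMField.complexConj L) 2).Adelic) =>
          mellin f (-((((1 / 2 : ℝ)) : ℂ) + p.1 * I)) * φ (p.2 : (quasiSplit (↥(maximalRealSubfield L)) L (IsCMField.complexConj L) 2).Adelic)) 2 ((volume : Measure ℝ).prod μK)),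
        Uod ⟨hv.toLp _, subset_resHBlock L μ K' ω χ ⟨f, hf.continuous, hfs, hf0, φ, hφ, hφc, hv, rfl⟩⟩ = ((Real.sqrt (C * (2 * π)⁻¹) : ℝ) : ℂ) • hw.toLp _ := by
  obtain ⟨C, hC, x, u, U, hx, hu, hU, -, heq⟩ := exists_offDual_isometry_resHBlock L μ K' ω νG μK νI h𝓕I ν h𝓕N h𝓕c h𝓕₀ hχu hoff
  refine ⟨C, hC, U.comp (LinearIsometryEquiv.ofEq _ _ heq.symm).toLinearIsometry, ?_⟩
  intro f hf hfs hf0 φ hφ hφc hv hw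
  -- the brick is `x i` for `i = (f, φ)`, and its model vector is `u i`
  let i : ↥{p : (ℝ → ℂ) × ((quasiSplit (↥(maximalRealSubfield L)) L (IsCMField.complexConj L) 2).Adelic → ℂ) |
        ContDiff ℝ (⊤ : ℕ∞) p.1 ∧ HasCompactSupport p.1 ∧ tsupport p.1 ⊆ Ioi 0 ∧ p.2 ∈ chiSectionSpace χ K' (ω : ↥K' → ℂ) ∧ Continuous p.2} := ⟨(f, φ), hf, hfs, hf0, hφ, hφc⟩
  have hxi : x i = hv.toLp _ := Lp.ext ((hx i).trans hv.coeFn_toLp.symm)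
  have hui : u i = hw.toLp _ := Lp.ext ((hu i).trans hw.coeFn_toLp.symm)
  have h1 : (LinearIsometryEquiv.ofEq _ _ heq.symm).toLinearIsometry ⟨hv.toLp _, subset_resHBlock L μ K' ω χ ⟨f, hf.continuous, hfs, hf0, φ, hφ, hφc, hv, rfl⟩⟩ =
      ⟨x i, mem_topologicalClosure_span x i⟩ := Subtype.ext hxi.symm
  rw [LinearIsometry.coe_comp, Function.comp_apply, h1, hU i, hui]

/-! ## §4 `hOD` discharged for off-dual blocks -/

/-- **`hOD` FOR AN OFF-DUAL BLOCK, DISCHARGED**: for `χ` unitary and off-dual and any `(K′, ω)`, there is an off-dual model map `U = (0, U_od ∘ P_{Sc})` (★ `R90S8ResHBlockModelFamilyU2` §3) with NO pure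
atoms, `resHAtom U = ⊥`, and all-line block, `resHLine U = resHBlock` — modulo only the structural Haar data. [cite: MoeglinWaldspurger1995, IV.1.10, VI.2] -/
theorem exists_odModelMap_resHAtom_eq_bot {A : Type*} [AddCommGroup A] [Module ℂ A]
    (νG : Measure (quasiSplit (↥(maximalRealSubfield L)) L (IsCMField.complexConj L) 2).Adelic) [νG.IsHaarMeasure] [νG.IsInvInvariant]
    (μK : Measure ((standardMaximalCompactGL 2 L).comap (adelicVal (↥(maximalRealSubfield L)) L (IsCMField.complexConj L) 2 ((StdForm.antidiagonal 2).over L)) : Subgroup (quasiSplit (↥(maximalRealSubfield L)) L (IsCMField.complexConj L) 2).Adelic)) [μK.IsHaarMeasure]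
    (νI : Measure (AdeleRing (𝓞 L) L)ˣ) [νI.IsHaarMeasure]
    {𝓕I : Set (AdeleRing (𝓞 L) L)ˣ} (h𝓕I : IsIdeleClassDomain L 𝓕I)
    (ν : Measure ↥(adelicUnipotent (↥(maximalRealSubfield L)) L (IsCMField.complexConj L) 2)) [ν.IsHaarMeasure] {𝓕 : Set ↥(adelicUnipotent (↥(maximalRealSubfield L)) L (IsCMField.complexConj L) 2)}
    (h𝓕N : IsFundamentalDomain ↥(rationalUnipotent (↥(maximalRealSubfield L)) L (IsCMField.complexConj L) 2) 𝓕 ν) (h𝓕c : IsCompact (closure 𝓕)) (h𝓕₀ : ν 𝓕 ≠ 0)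
    {χ : HeckeCharacter L} (hχu : χ.IsUnitary) (hoff : ¬ (χ * (reflectChar (IsCMField.complexConj L) χ)⁻¹).IsNormTwist) :
    ∃ (Uod : ↥(resHBlock L μ K' ω χ) →ₗᵢ[ℂ] Lp ℂ 2 ((volume : Measure ℝ).prod μK)),
      haveI := completeSpace_resHBlock L μ K' ω χ
      resHAtom L μ (((0 : (quasiSplit (↥(maximalRealSubfield L)) L (IsCMField.complexConj L) 2).L2 μ →ₗ[ℂ] A).prod
          (Uod.toContinuousLinearMap.comp (resHBlock L μ K' ω χ).orthogonalProjectionOnto).toLinearMap)) K' ω χ = ⊥ ∧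
      resHLine L μ (((0 : (quasiSplit (↥(maximalRealSubfield L)) L (IsCMField.complexConj L) 2).L2 μ →ₗ[ℂ] A).prod
          (Uod.toContinuousLinearMap.comp (resHBlock L μ K' ω χ).orthogonalProjectionOnto).toLinearMap)) K' ω χ = resHBlock L μ K' ω χ := by
  obtain ⟨C, -, Uod, -⟩ := exists_offDual_isometry_resHBlock' L μ K' ω νG μK νI h𝓕I ν h𝓕N h𝓕c h𝓕₀ hχu hoff
  exact ⟨Uod, resHAtom_odModelMap_eq_bot L μ K' ω χ Uod, resHLine_odModelMap_eq_resHBlock L μ K' ω χ Uod⟩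

end Summit.HodgeConjecture.HodgeConjecture.R90.S8

end
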